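import Mathlib
import HarnessLib
import Summits.NavierStokesRegularity.FluidComputer.TriggeredTransfer

/-!
# Fluid computer, door N1-FC — the ZOOM MAP ON DATA `x ↦ c • w (c • (x - x₀))`: inverse, transport of the Clay clauses (4), energy

Cell `ns-blowup`, seat `ns-blowup-fc-prover-2` (D-0074 GROUP C «bridge support»); companion of
`TriggeredTransfer.lean` (seat `ns-blowup-fc-route`: the door vocabulary `TriggerScheme`, `Step`,
`Transfers`) and the calculus half of `TriggeredTransferRobust.lean` (this seat). LABEL: E–C
bookkeeping. WHAT THIS IS NOT: not Navier–Stokes evidence — elementary calculus and one change of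
variables for the map that `TriggerScheme.Step` uses to write its hand-over slice
`u T = x ↦ λ • w' (λ • (x - x₀))`; no scheme, flow or blow-up is asserted.

* `zoom c x₀ w = (x ↦ c • w (c • (x - x₀)))` (amplitude `× c`, length `× c⁻¹`: the `ν`-preserving
  parabolic scaling on data, Leray's similarity [cite: Leray1934, §20]) and `unzoom c x₀` (reads the
  unit-scale state off a zoomed slice): `zoom_unzoom`, `unzoom_zoom`, `unzoom_eq_zoom`,
  `norm_unzoom_sub_le` (a sup-tolerance `M·c` on the zoomed slice is a sup-tolerance `M` at unit scale);
* transport of Fefferman's datum clauses (A)(4) through the zoom, `c > 0`: `contDiff_zoom`,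
  `isDivFree_zoom`, `hasRapidSpatialDecay_zoom` (chain rule for `iteratedFDeriv` through `c • id` and a
  translation, weight comparison `1 + ‖x‖ ≤ (1 + ‖x₀‖) · max 1 c⁻¹ · (1 + ‖c • (x - x₀)‖)`),
  packaged as `clay_zoom` — in particular the junction datum `u T` of a step is again a Clay datum,
  hence `H¹` (what a cascade-gluing proof feeds to Tao's Cor. 11.4 on the unforced overlaps);
* `lintegral_enorm_sq_zoom`: `∫⁻ ‖zoom c x₀ w‖ₑ² = c² (c³)⁻¹ ∫⁻ ‖w‖ₑ²` (finite energy passes through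
  the zoom; `Literature.Analysis.FluidPDE.lintegral_comp_space_affine`).

0 sorry; axioms ⊆ {propext, Classical.choice, Quot.sound}. References: J. Leray, Acta Math. 63 (1934)
§20 [cite: Leray1934, §20]; C. L. Fefferman, Clay problem description, (4) [cite: FeffermanClay2006, (A) (4)].
-/

noncomputable section

namespace Summit.NavierStokesRegularity.FluidComputer.TriggeredTransfer

open Set MeasureTheory Function Module
open scoped ENNReal ContDiff NNReal
open Literature.Analysis.FluidPDE
open Literature.Analysis.FluidPDE.FluidComputer (E3 Vel)

/-! ## The zoom map on data and the transport of the Clay clauses -/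

/-- The `c`-ZOOM of a unit-scale state `w` centred at `x₀`: `x ↦ c • w (c • (x - x₀))` — amplitude
`× c`, length `× c⁻¹` (the `ν`-preserving parabolic scaling on data, Leray's similarity); for `c = λ`
this is the hand-over slice `u T` of `TriggerScheme.Step`. [folklore] -/
def zoom (c : ℝ) (x₀ : E3) (w : Vel) : Vel := fun x => c • w (c • (x - x₀))

/-- The inverse zoom: `y ↦ c⁻¹ • s (x₀ + c⁻¹ • y)` (reads the unit-scale state off a zoomed slice).
[folklore] -/
def unzoom (c : ℝ) (x₀ : E3) (s : Vel) : Vel := fun y => c⁻¹ • s (x₀ + c⁻¹ • y)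

/-- Unfolding `zoom`. [folklore] -/
@[simp] theorem zoom_apply (c : ℝ) (x₀ : E3) (w : Vel) (x : E3) :
    zoom c x₀ w x = c • w (c • (x - x₀)) := rfl

/-- Unfolding `unzoom`. [folklore] -/
@[simp] theorem unzoom_apply (c : ℝ) (x₀ : E3) (s : Vel) (y : E3) :
    unzoom c x₀ s y = c⁻¹ • s (x₀ + c⁻¹ • y) := rfl

/-- `unzoom` is itself a zoom: `unzoom c x₀ = zoom c⁻¹ (-(c • x₀))`. [folklore] -/
theorem unzoom_eq_zoom {c : ℝ} (hc : c ≠ 0) (x₀ : E3) (s : Vel) :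
    unzoom c x₀ s = zoom c⁻¹ (-(c • x₀)) s := by
  funext y
  simp only [unzoom_apply, zoom_apply, sub_neg_eq_add, smul_add, smul_smul, inv_mul_cancel₀ hc,
    one_smul, add_comm x₀]

/-- `zoom c x₀ (unzoom c x₀ s) = s` for `c ≠ 0`. [folklore] -/
theorem zoom_unzoom {c : ℝ} (hc : c ≠ 0) (x₀ : E3) (s : Vel) : zoom c x₀ (unzoom c x₀ s) = s := by
  funext x
  simp only [zoom_apply, unzoom_apply, smul_smul, mul_inv_cancel₀ hc, one_smul, inv_mul_cancel₀ hc,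
    add_sub_cancel]

/-- `unzoom c x₀ (zoom c x₀ w) = w` for `c ≠ 0`. [folklore] -/
theorem unzoom_zoom {c : ℝ} (hc : c ≠ 0) (x₀ : E3) (w : Vel) : unzoom c x₀ (zoom c x₀ w) = w := by
  funext y
  simp only [unzoom_apply, zoom_apply, add_sub_cancel_left, smul_smul, inv_mul_cancel₀ hc, one_smul,
    mul_inv_cancel₀ hc]

/-- Reading a tolerance off a zoomed slice: if `s` is within sup-distance `M·c` of `zoom c x₀ w`
(`c > 0`), then `unzoom c x₀ s` is within sup-distance `M` of `w`. [folklore] -/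
theorem norm_unzoom_sub_le {c : ℝ} (hc : 0 < c) {x₀ : E3} {s w : Vel} {M : ℝ}
    (h : ∀ x, ‖s x - zoom c x₀ w x‖ ≤ M * c) (y : E3) : ‖unzoom c x₀ s y - w y‖ ≤ M := by
  have hx := h (x₀ + c⁻¹ • y)
  rw [zoom_apply, add_sub_cancel_left, smul_smul, mul_inv_cancel₀ hc.ne', one_smul] at hx
  have key : unzoom c x₀ s y - w y = c⁻¹ • (s (x₀ + c⁻¹ • y) - c • w y) := by
    rw [unzoom_apply, smul_sub, smul_smul, inv_mul_cancel₀ hc.ne', one_smul]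
  rw [key, norm_smul, norm_inv, Real.norm_of_nonneg hc.le]
  calc c⁻¹ * ‖s (x₀ + c⁻¹ • y) - c • w y‖ ≤ c⁻¹ * (M * c) :=
        mul_le_mul_of_nonneg_left hx (inv_nonneg.2 hc.le)
    _ = M := by field_simp

/-- The zoom of a `Cⁿ` field is `Cⁿ`. [folklore] -/
theorem contDiff_zoom {n : WithTop ℕ∞} {w : Vel} (hw : ContDiff ℝ n w) (c : ℝ) (x₀ : E3) :
    ContDiff ℝ n (zoom c x₀ w) :=
  (hw.comp ((contDiff_id.sub contDiff_const).const_smul c)).const_smul c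

/-- The zoom of a differentiable divergence-free field is divergence free
(`div (c • w ∘ A) = c · c · (div w) ∘ A` for the affine map `A x = c • (x - x₀)`). [folklore] -/
theorem isDivFree_zoom {w : Vel} (hw : Differentiable ℝ w) (hdiv : NSWave0.IsDivFree w) (c : ℝ)
    (x₀ : E3) : NSWave0.IsDivFree (zoom c x₀ w) := by
  intro x
  have hA : HasFDerivAt (fun y : E3 => c • (y - x₀)) (c • ContinuousLinearMap.id ℝ E3) x :=
    ((hasFDerivAt_id x).sub_const x₀).fun_const_smul c
  have hcomp : HasFDerivAt (fun y : E3 => w (c • (y - x₀)))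
      ((fderiv ℝ w (c • (x - x₀))).comp (c • ContinuousLinearMap.id ℝ E3)) x :=
    (hw _).hasFDerivAt.comp x hA
  have hz : HasFDerivAt (zoom c x₀ w)
      (c • ((fderiv ℝ w (c • (x - x₀))).comp (c • ContinuousLinearMap.id ℝ E3))) x :=
    hcomp.const_smul c
  have h0 : LinearMap.trace ℝ E3 (fderiv ℝ w (c • (x - x₀)) : E3 →ₗ[ℝ] E3) = 0 := hdiv (c • (x - x₀))
  show LinearMap.trace ℝ E3 (fderiv ℝ (zoom c x₀ w) x : E3 →ₗ[ℝ] E3) = 0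
  rw [hz.fderiv, ContinuousLinearMap.comp_smul, ContinuousLinearMap.comp_id, smul_smul,
    ContinuousLinearMap.toLinearMap_smul, map_smul, h0, smul_zero]

/-- **Rapid spatial decay (Fefferman (4)) is preserved by the zoom** `x ↦ c • w (c • (x - x₀))`,
`c > 0`, of a smooth field: chain rule for `iteratedFDeriv` through the linear map `c • id` and the
translation, and the weight comparison `1 + ‖x‖ ≤ (1 + ‖x₀‖) · max 1 c⁻¹ · (1 + ‖c • (x - x₀)‖)`.
[folklore] -/
theorem hasRapidSpatialDecay_zoom {w : Vel} (hw : ContDiff ℝ ∞ w) (hd : HasRapidSpatialDecay w)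
    {c : ℝ} (hc : 0 < c) (x₀ : E3) : HasRapidSpatialDecay (zoom c x₀ w) := by
  intro n K
  obtain ⟨C, hC⟩ := hd n K
  have hC0 : 0 ≤ C := le_trans (by positivity) (hC 0)
  set m : ℝ := (1 + ‖x₀‖) * max 1 c⁻¹ with hm
  have hm0 : 0 ≤ m := by positivity
  refine ⟨m ^ K * (c * c ^ n) * C, fun x => ?_⟩
  set L : E3 →L[ℝ] E3 := c • ContinuousLinearMap.id ℝ E3 with hL
  have hLx : ∀ y : E3, L y = c • y := fun y => by simp [hL]
  -- the zoom as `c • ((w ∘ L) ∘ (· - x₀))`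
  set g : E3 → E3 := w ∘ (L : E3 → E3) with hg
  have hfun : zoom c x₀ w = c • fun x => g (x - x₀) := by
    funext y
    simp [hg, hLx]
  have hun : ContDiff ℝ n w := hw.of_le (by exact_mod_cast le_top)
  have hgn : ContDiff ℝ n g := hun.comp L.contDiff
  have hgs : ContDiff ℝ n (fun x => g (x - x₀)) := hgn.comp (contDiff_id.sub contDiff_const)
  have hnorm_L : ‖L‖ ≤ c := by
    rw [hL]
    calc ‖c • ContinuousLinearMap.id ℝ E3‖ ≤ ‖c‖ * ‖ContinuousLinearMap.id ℝ E3‖ :=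
          (norm_smul_le c (ContinuousLinearMap.id ℝ E3))
      _ ≤ c * 1 := by
          rw [Real.norm_eq_abs, abs_of_pos hc]
          exact mul_le_mul_of_nonneg_left ContinuousLinearMap.norm_id_le hc.le
      _ = c := mul_one c
  -- the derivative of the zoomed field
  have hD : ‖iteratedFDeriv ℝ n (zoom c x₀ w) x‖ ≤
      c * c ^ n * ‖iteratedFDeriv ℝ n w (L (x - x₀))‖ := by
    rw [hfun, iteratedFDeriv_const_smul_apply hgs.contDiffAt, norm_smul, Real.norm_eq_abs,
      abs_of_pos hc, iteratedFDeriv_comp_sub, hg, L.iteratedFDeriv_comp_right hun _ le_rfl, mul_assoc]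
    refine mul_le_mul_of_nonneg_left ?_ hc.le
    calc ‖(iteratedFDeriv ℝ n w (L (x - x₀))).compContinuousLinearMap fun _ => L‖
        ≤ ‖iteratedFDeriv ℝ n w (L (x - x₀))‖ * ∏ _i : Fin n, ‖L‖ :=
          ContinuousMultilinearMap.norm_compContinuousLinearMap_le _ _
      _ ≤ ‖iteratedFDeriv ℝ n w (L (x - x₀))‖ * c ^ n := by
          rw [Finset.prod_const, Finset.card_univ, Fintype.card_fin]
          exact mul_le_mul_of_nonneg_left (pow_le_pow_left₀ (norm_nonneg _) hnorm_L n)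
            (norm_nonneg _)
      _ = c ^ n * ‖iteratedFDeriv ℝ n w (L (x - x₀))‖ := mul_comm _ _
  -- the weight
  have hw1 : 1 + ‖x‖ ≤ m * (1 + ‖L (x - x₀)‖) := by
    rw [hLx, norm_smul, Real.norm_eq_abs, abs_of_pos hc]
    have h1 : ‖x‖ ≤ ‖x - x₀‖ + ‖x₀‖ := by
      calc ‖x‖ = ‖(x - x₀) + x₀‖ := by rw [sub_add_cancel]
        _ ≤ ‖x - x₀‖ + ‖x₀‖ := norm_add_le _ _
    have h2 : ‖x - x₀‖ ≤ max 1 c⁻¹ * (c * ‖x - x₀‖) := by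
      calc ‖x - x₀‖ = c⁻¹ * (c * ‖x - x₀‖) := by
            rw [← mul_assoc, inv_mul_cancel₀ hc.ne', one_mul]
        _ ≤ max 1 c⁻¹ * (c * ‖x - x₀‖) :=
            mul_le_mul_of_nonneg_right (le_max_right _ _) (by positivity)
    have h3 : (1 : ℝ) ≤ max 1 c⁻¹ := le_max_left _ _
    have h4 : 0 ≤ ‖x₀‖ := norm_nonneg _
    have h5 : 0 ≤ c * ‖x - x₀‖ := by positivity
    rw [hm]
    nlinarith [h1, h2, h3, h4, h5, mul_nonneg h4 (le_trans zero_le_one h3),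
      mul_nonneg h4 (mul_nonneg (le_trans zero_le_one h3) h5)]
  have hwK : (1 + ‖x‖) ^ K ≤ m ^ K * (1 + ‖L (x - x₀)‖) ^ K := by
    rw [← mul_pow]
    exact pow_le_pow_left₀ (by positivity) hw1 K
  have hCy := hC (L (x - x₀))
  calc (1 + ‖x‖) ^ K * ‖iteratedFDeriv ℝ n (zoom c x₀ w) x‖
      ≤ (m ^ K * (1 + ‖L (x - x₀)‖) ^ K) * (c * c ^ n * ‖iteratedFDeriv ℝ n w (L (x - x₀))‖) :=
        mul_le_mul hwK hD (norm_nonneg _) (by positivity)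
    _ = m ^ K * (c * c ^ n) * ((1 + ‖L (x - x₀)‖) ^ K * ‖iteratedFDeriv ℝ n w (L (x - x₀))‖) := by
        ring
    _ ≤ m ^ K * (c * c ^ n) * C := mul_le_mul_of_nonneg_left hCy (by positivity)

/-- The three Clay clauses (4) — smooth, divergence free, rapidly decaying — pass through the zoom
(`c > 0`). [cite: FeffermanClay2006, (A) (4)] -/
theorem clay_zoom {w : Vel} (h : ContDiff ℝ ∞ w ∧ NSWave0.IsDivFree w ∧ HasRapidSpatialDecay w)
    {c : ℝ} (hc : 0 < c) (x₀ : E3) :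
    ContDiff ℝ ∞ (zoom c x₀ w) ∧ NSWave0.IsDivFree (zoom c x₀ w) ∧
      HasRapidSpatialDecay (zoom c x₀ w) :=
  ⟨contDiff_zoom h.1 c x₀, isDivFree_zoom (h.1.differentiable (by simp)) h.2.1 c x₀,
    hasRapidSpatialDecay_zoom h.1 h.2.2 hc x₀⟩

/-- Energy of a zoomed state: `∫⁻ ‖zoom c x₀ w‖ₑ² = c² · (c³)⁻¹ · ∫⁻ ‖w‖ₑ²` (`c > 0`; the factor is
`c⁻¹`, kept in the product form the change of variables delivers). [folklore] -/
theorem lintegral_enorm_sq_zoom {c : ℝ} (hc : 0 < c) (x₀ : E3) (w : Vel) :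
    ∫⁻ x, ‖zoom c x₀ w x‖ₑ ^ 2 =
      ENNReal.ofReal (c ^ 2) * ENNReal.ofReal (c ^ 3)⁻¹ * ∫⁻ x, ‖w x‖ₑ ^ 2 := by
  have h1 : ∀ x, ‖zoom c x₀ w x‖ₑ ^ 2 =
      ENNReal.ofReal (c ^ 2) * (fun y => ‖w y‖ₑ ^ 2) (-(c • x₀) + c • x) := by
    intro x
    rw [zoom_apply, smul_sub, sub_eq_neg_add, enorm_smul, mul_pow, Real.enorm_eq_ofReal hc.le,
      ENNReal.ofReal_pow hc.le]
  simp_rw [h1]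
  rw [lintegral_const_mul' _ _ ENNReal.ofReal_ne_top,
    lintegral_comp_space_affine hc (-(c • x₀)) (fun y => ‖w y‖ₑ ^ 2), finrank_euclideanSpace_fin,
    mul_assoc]

end Summit.NavierStokesRegularity.FluidComputer.TriggeredTransfer

end
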